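import Mathlib
import Literature.AlgebraicGeometry.Resolution.ReflexiveModulesRationalDoublePoints
import Literature.AlgebraicGeometry.Morphisms.DevissageClass
import Literature.AlgebraicGeometry.Modules.SheafHomFrames
import Literature.AlgebraicGeometry.Modules.SheafHomCoh
import Literature.AlgebraicGeometry.Modules.KernelFiniteLocallyFree
import Literature.AlgebraicGeometry.Modules.AffineLocalizingClosure
import Literature.AlgebraicGeometry.Modules.FiniteType
import Summits.ResolutionOfSingularities.ResolutionOfSingularities.Theorems.HomologicalConductorNoZenoFullSheafMaps
import HarnessLib

/-!
# Crux `NoZenoR` (stmt-ResolutionOfSingularities-19943), line `sandwich-cluster`, G-layer: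
# coherence of the full sheaf `M~` of a finitely generated module, and of `𝓗om(M~, ker q)` (G2 A1/A2)

OURS (cell res-hironaka, chain W4.4; KERNEL-L0 §16 R6 row G2, holder res-D-pv-045 AS res-L0-w44-stub-8;
assembly plan `D/res-D-pv-045/SketchG2Assembly.lean` items A1, A2). Nothing of [claim: Hironaka2017] used.

* `germToFunctionField_map_top`, `base_smul_top_eq` — the `Γ(X, ⊤)`- and `Γ(X, U)`-actions on `V` agree;
* **`isAffineFiniteType_generatedSheaf_of_subset_span`** — if `S ⊆ Γ(X, ⊤) · G` for a finite `G ⊆ V`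
  then `𝒪_X · S` is of affine-finite type on a locally noetherian `X` (its sections over an affine `U`
  are `Γ(X,U) · S ≤ Γ(X,U) · G`, a submodule of a finitely generated module over the noetherian
  `Γ(X, U)`); `coh_generatedSheaf_of_subset_span` — hence coherent (affine-localizing by p502652);
* **`coh_fullSheaf`** (A1) — for an `O`-scheme `π : X ⟶ Spec O`, a finitely generated `O`-module `M` and
  `φ : M →+ V` semilinear along `baseToFunctionField π` (the tree's `IsChernDivisorOfFullSheaf`
  convention), the full sheaf `M~ = 𝒪_X · φ(M)` is coherent (`baseToFunctionField_smul_eq`: the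
  `O`-action through `baseToFunctionField` is the `Γ(X, ⊤)`-action through `algebraMapΓ`);
* **`isFiniteLocallyFree_and_coh_sheafHom_kernel`** (A2) — for an epimorphism `q : P ⟶ E` of finite
  locally free coherent modules, `𝓗om(E, ker q)` is finite locally free and coherent (tree:
  `isFiniteLocallyFree_kernel`, `isFiniteLocallyFree_sheafHom'`, `IsAffineLocalizing.kernel`,
  `IsAffineFiniteType.kernel`, `coh_sheafHom`).

Everything is proved; no named facts. [this work]
-/

-- single-problem summit: the doubled namespace component `ResolutionOfSingularities` is forced
set_option linter.dupNamespace false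

noncomputable section

universe u

open CategoryTheory CategoryTheory.Limits AlgebraicGeometry TopologicalSpace Opposite
open Literature.AlgebraicGeometry.Morphisms Literature.AlgebraicGeometry.Modules
open Literature.AlgebraicGeometry.Motives Literature.AlgebraicGeometry.Resolution

namespace Summit.ResolutionOfSingularities.ResolutionOfSingularities.Theorems.NoZeno.SandwichCluster.FullSheaf

variable {X : Scheme.{u}} [IsIntegral X]
variable (V : Type u) [AddCommGroup V] [Module X.functionField V] (S : Set V)

attribute [local instance] stalkModule stalk_isScalarTower fnModule baseModule

/-! ## The global action `Γ(X, ⊤) → K(X)` versus the local ones -/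

/-- `X` is non-empty, so `⊤` is a non-empty open. [folklore] -/
theorem nonempty_top : Nonempty (⊤ : X.Opens) := ⟨⟨genericPoint X, trivial⟩⟩

attribute [local instance] nonempty_top

/-- Restriction from `⊤` does not change the image in `K(X)`. [folklore] -/
theorem germToFunctionField_map_top (U : X.Opens) [Nonempty U] (g : Γ(X, ⊤)) :
    X.germToFunctionField U (X.presheaf.map (homOfLE le_top).op g) = X.germToFunctionField ⊤ g :=
  germToFunctionField_map (le_top : U ≤ ⊤) g

/-- The `Γ(X, ⊤)`-action on `V` is the `Γ(X, U)`-action of the restriction. [folklore] -/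
theorem base_smul_top_eq (U : X.Opens) [Nonempty U] (g : Γ(X, ⊤)) (v : V) :
    g • v = X.presheaf.map (homOfLE (le_top : U ≤ ⊤)).op g • v := by
  rw [base_smul_def, base_smul_def, germToFunctionField_map_top]

/-- `Γ(X, ⊤) · G ⊆ Γ(X, U) · G` for every non-empty open `U`. [folklore] -/
theorem span_top_le_span (U : X.Opens) [Nonempty U] (G : Set V) :
    ((Submodule.span Γ(X, ⊤) G : Submodule Γ(X, ⊤) V) : Set V) ⊆
      (Submodule.span Γ(X, U) G : Submodule Γ(X, U) V) := by
  intro v hv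
  induction hv using Submodule.span_induction with
  | mem w hw => exact Submodule.subset_span hw
  | zero => exact Submodule.zero_mem _
  | add w w' _ _ hw hw' => exact Submodule.add_mem _ hw hw'
  | smul g w _ hw =>
    rw [SetLike.mem_coe, base_smul_top_eq V U g w]
    exact Submodule.smul_mem _ _ hw

/-! ## A1. Coherence of `𝒪_X · S` when `S` lies in the span of finitely many vectors -/

/-- **Affine-finite type from a finite spanning set**: if `S ⊆ Γ(X, ⊤) · G` with `G` finite, then the
sections of `𝒪_X · S` over every affine open form a finitely generated `Γ(X, U)`-module (`X` locally
noetherian). [folklore] -/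
theorem isAffineFiniteType_generatedSheaf_of_subset_span [IsLocallyNoetherian X] (G : Set V) (hG : G.Finite)
    (hSG : S ⊆ (Submodule.span Γ(X, ⊤) G : Submodule Γ(X, ⊤) V)) :
    IsAffineFiniteType (generatedSheaf (X := X) V S) := by
  intro U hU
  rcases isEmpty_or_nonempty U with hUe | ⟨⟨x⟩⟩
  · refine ⟨⟨∅, ?_⟩⟩
    rw [Finset.coe_empty, Submodule.span_empty]
    refine le_antisymm bot_le fun s _ => ?_
    rw [Submodule.mem_bot]
    exact section_eq_zero_of_isEmpty V S hUe s
  · haveI : Nonempty U := ⟨x⟩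
    haveI : IsNoetherianRing Γ(X, U) := IsLocallyNoetherian.component_noetherian ⟨U, hU⟩
    -- `Γ(X,U) · S ≤ Γ(X,U) · G`, a submodule of a finitely generated module
    have hle : (Submodule.span Γ(X, U) S : Submodule Γ(X, U) V) ≤ Submodule.span Γ(X, U) G :=
      Submodule.span_le.mpr fun v hv => span_top_le_span V U G (hSG hv)
    have hfgG : (Submodule.span Γ(X, U) G : Submodule Γ(X, U) V).FG := Submodule.fg_def.mpr ⟨G, hG, rfl⟩
    have hfgS : (Submodule.span Γ(X, U) S : Submodule Γ(X, U) V).FG := Submodule.FG.of_le hfgG hle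
    haveI : Module.Finite Γ(X, U) (Submodule.span Γ(X, U) S : Submodule Γ(X, U) V) :=
      ⟨(Submodule.fg_top _).mpr hfgS⟩
    exact Module.Finite.equiv (sectionsEquivSpan V S hU x).symm

/-- **`𝒪_X · S` is coherent when `S ⊆ Γ(X, ⊤) · G`, `G` finite** (affine-localizing by p502652,
affine-finite type by the previous lemma). [folklore] -/
theorem coh_generatedSheaf_of_subset_span [IsLocallyNoetherian X] (G : Set V) (hG : G.Finite)
    (hSG : S ⊆ (Submodule.span Γ(X, ⊤) G : Submodule Γ(X, ⊤) V)) :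
    Coh (generatedSheaf (X := X) V S) :=
  ⟨isAffineLocalizing_generatedSheaf V S, isAffineFiniteType_generatedSheaf_of_subset_span V S G hG hSG⟩

/-! ## A1 for the full sheaf `M~ = 𝒪_X · φ(M)` of a finitely generated module -/

section Full

variable {O : Type u} [CommRing O] (π : X ⟶ Spec (.of O))
variable {M : Type*} [AddCommGroup M] [Module O M]

/-- The `O`-action on `V` through `baseToFunctionField π : O → K(X)` is the `Γ(X, ⊤)`-action through
`algebraMapΓ π : O → Γ(X, 𝒪_X)`. [folklore] -/
theorem baseToFunctionField_smul_eq (a : O) (v : V) :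
    baseToFunctionField π a • v = (Literature.AlgebraicGeometry.Morphisms.algebraMapΓ π a) • v := rfl

/-- **A1. The full sheaf of a finitely generated module is coherent**: for `φ : M →+ V` semilinear along
`baseToFunctionField π` (`φ (a • m) = baseToFunctionField π a • φ m`) and `M` finitely generated over `O`,
`M~ := 𝒪_X · φ(M)` is coherent on the locally noetherian integral `X` (`φ(M)` is the `Γ(X, ⊤)`-span of the
images of finitely many generators). [this work] -/
theorem coh_fullSheaf [IsLocallyNoetherian X] [Module.Finite O M] (φ : M →+ V)
    (hφ : ∀ (a : O) (m : M), φ (a • m) = baseToFunctionField π a • φ m) :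
    Coh (generatedSheaf (X := X) V (Set.range φ)) := by
  classical
  obtain ⟨n, g, hg⟩ := Module.Finite.exists_fin (R := O) (M := M)
  refine coh_generatedSheaf_of_subset_span V (Set.range φ) (Set.range fun i => φ (g i))
    (Set.finite_range _) ?_
  rintro _ ⟨m, rfl⟩
  have hm : m ∈ Submodule.span O (Set.range g) := by rw [hg]; trivial
  induction hm using Submodule.span_induction with
  | mem w hw =>
    obtain ⟨i, rfl⟩ := hw
    exact Submodule.subset_span ⟨i, rfl⟩
  | zero => rw [map_zero]; exact Submodule.zero_mem _
  | add w w' _ _ hw hw' => rw [map_add]; exact Submodule.add_mem _ hw hw'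
  | smul a w _ hw =>
    rw [SetLike.mem_coe, hφ, baseToFunctionField_smul_eq]
    exact Submodule.smul_mem _ _ hw

end Full

end Summit.ResolutionOfSingularities.ResolutionOfSingularities.Theorems.NoZeno.SandwichCluster.FullSheaf

/-! ## A2. `𝓗om(E, ker q)` for an epimorphism of finite locally free coherent modules -/

namespace Summit.ResolutionOfSingularities.ResolutionOfSingularities.Theorems.NoZeno.SandwichCluster.FullSheaf

variable {X : Scheme.{u}} [IsLocallyNoetherian X]

/-- **A2. `F := 𝓗om(E, ker q)` is finite locally free and coherent** for an epimorphism `q : P ⟶ E`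
between finite locally free coherent `𝒪_X`-modules on a locally noetherian scheme. In G2: `E = M~`
(finite locally free by (iv)), `P = 𝒪_X^N`, `F` the sheaf whose `Ȟ¹` computes `End̲_T(M)`.
[this work] -/
theorem isFiniteLocallyFree_and_coh_sheafHom_kernel {P E : X.Modules} (q : P ⟶ E) [Epi q]
    (hP : IsFiniteLocallyFree P) (hE : IsFiniteLocallyFree E) (hPc : Coh P) (hEc : Coh E) :
    IsFiniteLocallyFree (sheafHom E (kernel q)) ∧ Coh (sheafHom E (kernel q)) := by
  have hK : IsFiniteLocallyFree (kernel q) := isFiniteLocallyFree_kernel q hP hE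
  have hKc : Coh (kernel q) :=
    ⟨IsAffineLocalizing.kernel q hPc.loc hEc.loc, IsAffineFiniteType.kernel q hPc.ft⟩
  exact ⟨isFiniteLocallyFree_sheafHom' hE hK, coh_sheafHom hEc hKc⟩

end Summit.ResolutionOfSingularities.ResolutionOfSingularities.Theorems.NoZeno.SandwichCluster.FullSheaf

end
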